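import Literature.IUT.HodgeTheaters.BadLocalFrobenioidOfKitsTemperedBiratReal
import Literature.IUT.HodgeTheaters.GenuineFKitOfBadLocalTemperedCFromFSlim
import Literature.IUT.HodgeTheaters.GenuineFKitOfBadLocalTemperedSideNV
import Literature.IUT.HodgeTheaters.GenuineFKitMergeInputsThetaSide
import Literature.AnabelianGeometry.EtaleTheta.ThetaFractionPairOfThetaTwistTower
import Literature.AnabelianGeometry.EtaleTheta.TemperedFrobenioidOfGaloisCoveringTateTowerArith
import Literature.AnabelianGeometry.EtaleTheta.Discharge.Sec3Cor38iiSelfEquivalenceWeak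
import Literature.IUT.HodgeTheaters.GaloisValDatumCoveringMonoid
import Literature.IUT.HodgeTheaters.GaloisValDatumOfComplete
import Summits.ABC.ABC.Theses.IUTThetaPilot
import HarnessLib

/-!
# GAP-SIZING A (abc-iut-inv-1, cycle 4, lens `nearmiss`) — SIGNATURES-ONLY sketch for GAP G-L5-EX32I-1

Nothing is proved or asserted here.  §1 states, over EXISTING declarations only, the exact TYPE of the producer the L5 chair
accepts (abc-iut-L5-lead g14 RULINGS #317 (2), 2026-08-28T15:22:56Z): a `def`-level section of the family
`x hx T ↦ D.BadTemperedRestBirat B x hx T` (written as `Nonempty`-shadow `example`s, because a sketch may not construct data and adds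
no declaration to the tree); §2 pins BY NAME (`example := @…`) the slot types, the two MODEL inhabitants of record, the landed INPUT-SHAPE
theorems that flip [IUTchI] Ex 3.2 (ii)/(iii) once a genuine `Fr` exists, and the landed L1/L2 engines the producer would
consume; §3 pins the crux of record `ThetaPartII` (width-0 change: the gap lives in `Literature.IUT.HodgeTheaters` /
`Literature.AnabelianGeometry.EtaleTheta`, not in the `LogVolume` layer).  HONEST: typed ≠ inhabited ≠ proved-in-print; a sized
plan is not a result; no side taken on [IUTchIII] Cor 3.12; nothing here asserts abc proved or refuted; no instance, no notation,
no sorry.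
-/

set_option linter.dupNamespace false

noncomputable section

namespace Summit.ABC.ABC.Cruxes.ThetaPartII.GapSizingA1

open Literature.IUT.HodgeTheaters Literature.AnabelianGeometry.EtaleTheta Literature.AlgebraicGeometry.Frobenioids
  Literature.AnabelianGeometry.SemiGraphs

/-! ## §1 The producer's type (RULINGS #317 (2)): pointwise-generic in `(D, x, T)`, over the kit's own `Π = ↥(B x hx).H` -/

section Producer

variable {F K Fbar : Type} [Field F] [NumberField F] [Field K] [NumberField K] [Algebra F K]
  [Field Fbar] [Algebra F Fbar] [Algebra K Fbar] {E : WeierstrassCurve F}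
  [E.IsElliptic] {l : ℕ} {Pb : BadPlacePredicates K}

/-- PRODUCER A («ProducerAShadow D B») — `Nonempty` shadow of the deliverable `def badTemperedRestArith … : D.BadTemperedRestBirat B x hx T`
(REAL-birationalization rest form: `Fr` an [EtTh] Def 3.6 tempered Frobenioid over `CosetCat ↥(B x hx).H`, `hF`, `Θ̲_v̲ ∈ BiratUnits`,
`l·ℤ`, constants, `CdashToC` faithful over `𝒟⊢ ⊆ 𝒟`, `CThetaToBirat`).  The token standard wants the `def`, not this Prop; written as an
`example` so that no Prop-valued declaration is added to the tree. -/
example (D : InitialThetaData F K Fbar E l Pb) (B : ∀ v, v ∈ D.indexCopyBad → D.BadPairAt v) : Prop :=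
  ∀ (x : D.IndexCopy) (hx : x ∈ D.indexCopyBad)
    (T : BadLocalGroupDatum (D.GalAt x (D.not_mem_arc_of_mem_bad hx)) ↥(B x hx).H),
    Nonempty (D.BadTemperedRestBirat.{0} B x hx T)

/-- («ProducerAShadowRest D B») the weaker rest form (`BiratFromF` then needs `hF`, `hb`): shadow of an inhabitant of `BadTemperedRest`. -/
example (D : InitialThetaData F K Fbar E l Pb) (B : ∀ v, v ∈ D.indexCopyBad → D.BadPairAt v) : Prop :=
  ∀ (x : D.IndexCopy) (hx : x ∈ D.indexCopyBad)
    (T : BadLocalGroupDatum (D.GalAt x (D.not_mem_arc_of_mem_bad hx)) ↥(B x hx).H),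
    Nonempty (D.BadTemperedRest.{0} B x hx T)

/-- The real-birat form refines the rest form (`BadTemperedRestBirat.toRest`, by name). -/
example (D : InitialThetaData F K Fbar E l Pb) (B : ∀ v, v ∈ D.indexCopyBad → D.BadPairAt v)
    (h : ∀ (x : D.IndexCopy) (hx : x ∈ D.indexCopyBad)
      (T : BadLocalGroupDatum (D.GalAt x (D.not_mem_arc_of_mem_bad hx)) ↥(B x hx).H),
      Nonempty (D.BadTemperedRestBirat.{0} B x hx T))
    (x : D.IndexCopy) (hx : x ∈ D.indexCopyBad)
    (T : BadLocalGroupDatum (D.GalAt x (D.not_mem_arc_of_mem_bad hx)) ↥(B x hx).H) :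
    Nonempty (D.BadTemperedRest.{0} B x hx T) :=
  (h x hx T).map fun Rb => Rb.toRest

end Producer

/-! ## §2 Pins BY NAME (every cited declaration exists with its landed type; nothing re-typed) -/

-- the slot and its rest forms (★ p496697, ★ p498213, `…TemperedBiratReal`)
example := @InitialThetaData.MergeInputs.m1
example := @InitialThetaData.BadTemperedSide
example := @InitialThetaData.BadTemperedRest
example := @InitialThetaData.BadTemperedRestBirat
example := @InitialThetaData.BadTemperedRest.toSide
example := @InitialThetaData.BadTemperedRestBirat.toRest
example := @InitialThetaData.MergeInputs.ofRest
example := @InitialThetaData.MergeInputs.ofRestBirat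
example := @TemperedThetaInput
example := @TemperedThetaRest
example := @TemperedThetaRest.toInput
example := @TemperedThetaRestBirat
example := @BadLocalGroupDatum
-- the two MODEL inhabitants of record (m1 MODEL v1 ★ p500005; m1 MODEL v2) and the knit
example := @InitialThetaData.badTemperedSideModel
example := @InitialThetaData.badTemperedSideOfThetaTower
example := @InitialThetaData.nonempty_mergeInputs_iff
-- the landed INPUT-SHAPE theorems that flip (ii)/(iii) at a genuine `Fr` (★ p511072/p513174/p514234; ★ p498213; ★ p511706)
example := @InitialThetaData.biratFromF_frobeniusBadAt_ofRestBirat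
example := @InitialThetaData.ex32_ii_iii_frobeniusBadAt_ofRestBirat
example := @InitialThetaData.biratFromF_frobeniusBadAt_ofRest
example := @InitialThetaData.cFromF_frobeniusBadAt_ofRest
example := @InitialThetaData.cFromF_frobeniusBadAt_ofRest_of_isSlimGroup
example := @InitialThetaData.dFromF_frobeniusBadAt_ofRest_of_isClosed
example := @InitialThetaData.ex32_iii_vi_cd_frobeniusBadAt_ofRest
-- landed L1/L2 engines the producer consumes BY NAME
example := @PreFrobenioid.toBirat                        -- [FrdI] Prop 4.4 (sub-gap (b): IN TREE)
example := @PreFrobenioid.toBirat_faithful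
example := @TemperedFrobenioid                           -- [EtTh] Def 3.6 (ii)
example := @RealifiedDivisorMonoids                      -- [EtTh] Def 3.6 (i)
example := @RealifiedDivisorMonoids.ofRlfZWeak
example := @DivisorMonoids.ofGaloisActionConnected       -- [EtTh] Def 3.3 (iii) data of a Galois-action log-divisor model
example := @TemperedFrobenioid.hullFaithful_holds        -- [EtTh] Def 3.6 (iv) faithful hull
example := @TemperedFrobenioid.hull_selfEquivalence_weak_of_criteria  -- [EtTh] Cor 3.8 (ii) closer (L1-t12)
example := @TateTowerArithFrd.temperedFrobenioid         -- ARITHMETIC Tate tower (genuine valued constant field)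
example := @ThetaTwistTowerTempered.temperedFrobenioid   -- FOURTH model (μ_N + ϖ̈ + Ü + Θ̈), class (b)
example := @ThetaTwistTowerTempered.thetaUnit            -- Θ̈ ∈ O^×(A_⊙^birat) at the fourth model
example := @ThetaTwistTowerTempered.thetaFractionPair    -- its fraction-pair (sub-gap (b) content, class (b))
example := @GaloisValDatum.fixedFld                      -- the genuine constant tower U ↦ Ω^U
example := @GaloisValDatum.galAct_fixed_iff_exists_fixedFld  -- (Ω-integers)^U = integers of Ω^U
example := @GaloisValDatum.Cdash                         -- the REAL 𝒞⊢_v̲ (sub-gap (a) source)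
example := @GaloisValDatum.ofPlace                       -- genuine Galois-valuation datum at a place
example := @InitialThetaData.gvdAt
example := @InitialThetaData.qRootAtIdx                  -- genuine q̲_v̲ (★ p442528 lineage)

/-! ## §3 The crux of record is untouched (width 0) -/

example : Prop := Summit.ABC.ABC.Theses.IUTThetaPilot.ThetaPartII

end Summit.ABC.ABC.Cruxes.ThetaPartII.GapSizingA1

end
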